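import Summits.BirchSwinnertonDyer.BirchSwinnertonDyer.Theorems.ByReductionTypeAtTwoMultTowerLocalAddvPotGoodInertia
import HarnessLib

/-!
# Route `ByReductionTypeAtTwo`, crux `MultUpperHalfAtTwo` (item stmt-BirchSwinnertonDyer-19922): ONE BIT at an odd ADDITIVE prime of
# POTENTIALLY GOOD type — part 3: `#𝒦_{v,n}[2^∞] ≤ 2`, the certificate over `ℚ`, and the six-disjunct dispatcher

Part 3 of 3: at an additive `v ∤ 2` whose Kodaira type is not `I_n*`, Greenberg's local tower kernel `𝒦_{v,n}[2^∞]` has ORDER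
`≤ 2` at every layer of every `ℤ₂`-extension (tree `finite_and_natCard_localTowerKerPrimary_le_of_inertiaPrimary` + part 2 + «a `2`-group of
order `≤ 3` has order `≤ 2`»): ONE bit instead of the blanket two; the decidable certificate over `ℚ` (`ℓ ∣ c₄`, `ℓ^k ∥ Δ_min`, `1 ≤ k ≠ 6`,
`ℓ^k ∣ c₄³` ⟹ additive and not `I_n*`: `I₀*` has `ord Δ_min = 6` by the tree's Ogg-type theorem, `I_n*` (`n ≥ 1`) has `ord(j) < 0`); and the
per-place dispatcher `pTorsion_localTowerKer_le_of_numeric_addv2` = p505183's five disjuncts + «additive ∧ type ≠ I_n* ∧ 2 ≤ C».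
MEASURED (seat census): +30 `E[2]`-irreducible classes of item 19922 become predicted-feasible beyond the 191 of the zero-bit lever.
HONEST FRAMING (cell `bsd-2adic`, run/shared/lean/pub/bsd-2adic/, seat `bsd-2adic-mult-2` GEN 8, HUMAN RULINGS D-0036 / D-0054 /
D-0074 row (A)): research route; THEOREMS ONLY — no definition, no new named fact; nothing is booked; BSD is not proved by any of
this. PARTITION: X5@2 mult (K4ᵐ, RESIDUAL-MAP B1·O1; the 1 680 `E[2]`-irreducible classes) × p = 2 — types-the-object-of (the per-prime
local constant of the TOWER-gap certificate of item 19922 at an odd additive prime of potentially good type); closes none.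
WHAT IS DISPLAYED, NOT PROVED: nothing. ∀-LEVEL CONTENT: none.
References: R. Greenberg, LNM 1716 (1999), §3 Lemma 3.3 (pp. 86–88); J. H. Silverman, *AEC* (2009) Thm. VII.6.1; *ATAEC* (1994) IV.9.4,
Table 4.1, Cor. IV.9.2(d).
-/

set_option autoImplicit false
-- the Theorems namespace of this sub repeats the summit name by design (D-0017 nested layout: Summit.<S>.<Sub>)
set_option linter.dupNamespace false

noncomputable section

open scoped Classical NNReal
open NumberField IsDedekindDomain Field Polynomial IsLocalRing

universe u

/-! ## §3 `#𝒦_{v,n}[2^∞] ≤ 2` at an additive `v ∤ 2` of potentially good type (any number field, any `ℤ₂`-extension, every layer) -/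

namespace Summit.BirchSwinnertonDyer.BirchSwinnertonDyer.Theorems.MultTowerAddv

open Literature.NumberTheory.EllipticCurves Literature.NumberTheory.EllipticCurves.Greenberg1999
  Literature.NumberTheory.GaloisRepresentations
  Literature.NumberTheory.DiophantineGeometry Literature.NumberTheory.DiophantineGeometry.KodairaSymbol
  Field IsDedekindDomain.HeightOneSpectrum WeierstrassCurve Rat.HeightOneSpectrum

section LocalPotGood

variable {K : Type u} [Field K] [NumberField K] (W : WeierstrassCurve K) {v : HeightOneSpectrum (𝓞 K)}
  (κ : ZpExtension K 2)

set_option maxHeartbeats 1600000 in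
/-- **`𝒦_{v,n}[2^∞]` has ORDER `≤ 2` at an additive `v ∤ 2` whose Kodaira type is not `I_n*`**, at EVERY layer `n` of ANY
`ℤ₂`-extension: `#𝒦_{v,n}[2^∞] ≤ #E(K̄_v)^{I}[2^∞]` (tree `finite_and_natCard_localTowerKerPrimary_le_of_inertiaPrimary`, Greenberg
pp. 87–88), the latter is `≤ 3` (§2) and a power of `2`. The tree's `finite_and_natCard_localTowerKerPrimary_le_four_of_additive` VERBATIM
with `3` for `4` and the final count. [cite: GreenbergLNM1716, §3 Lemma 3.3 (proof, PDF pp. 87–88)] [cite: SilvermanAEC2009, Thm. VII.6.1]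
[cite: SilvermanATAEC1994, Cor. IV.9.2(d) with Table 4.1] -/
theorem finite_and_natCard_localTowerKerPrimary_le_two_of_additive_of_ne_Istar [W.IsElliptic]
    (hpv : ((2 : ℕ) : 𝓞 K) ∉ v.asIdeal) (hadd : W.HasAdditiveReductionAt v)
    (hpg : ∀ n, W.kodairaSymbolAt v ≠ .Istar n) (n : ℕ) :
    Finite (W.localTowerKerPrimary κ (v.adicCompletion K) n) ∧
      Nat.card (W.localTowerKerPrimary κ (v.adicCompletion K) n) ≤ 2 := by
  classical
  haveI : Fact (Nat.Prime 2) := ⟨Nat.prime_two⟩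
  let G : Type u := Field.absoluteGaloisGroup (v.adicCompletion K)
  let Pt : Type u := localPoints W (v.adicCompletion K)
  -- the prime `𝔐`, a Frobenius, the generator `g = F^M`
  obtain ⟨𝔐, h𝔐⟩ := v.localPrimesAbove_nonempty
  haveI hInormal : (𝔐.inertia G).Normal := inertia_normal_of_mem_localPrimesAbove v h𝔐
  obtain ⟨F, hF⟩ := exists_isArithFrobAt_localAbsIntegers (v := v) h𝔐
  obtain ⟨M, -, hgHn, hgen⟩ := exists_frobenius_pow_generate_localSubgroup κ hpv h𝔐 hF n
  obtain ⟨w, hw⟩ := v.exists_spectralValuation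
  -- the minimal model and the equivariant transport
  set X := W.localMinimalModel v with hXdef
  haveI : X.IsElliptic := W.isElliptic_localMinimalModel v
  haveI : X.HasAdditiveReduction (v.adicCompletionIntegers K) := hadd
  have hpg' : ∀ m, (X.integralModel (v.adicCompletionIntegers K)).kodairaSymbolOfMinimal ≠ .Istar m := by
    intro m h
    exact hpg m (by rw [kodairaSymbolAt_def]; exact h)
  obtain ⟨hfinS, hS⟩ :=
    X.finite_and_natCard_inertiaFixed_primary_le_three_of_hasAdditiveReduction_of_ne_Istar w hw h𝔐 Nat.prime_two hpv hpg'
  obtain ⟨C, hC⟩ := W.exists_variableChange_smul_eq_localMinimalModel v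
  obtain ⟨Φ, hΦ⟩ := W.exists_addEquiv_localPoints_of_smul_eq v hC
  -- `B' = E(K̄_v)^{I}[2^∞]` injects into the counted set
  set Mi : AddSubgroup Pt := FixedPoints.addSubgroup (𝔐.inertia G) Pt with hMi
  set B : AddSubgroup Mi := AddCommGroup.primaryComponent Mi 2 with hB
  let j : B → {P : (X.baseChange (AlgebraicClosure (v.adicCompletion K))).toAffine.Point //
        (∀ σ ∈ 𝔐.inertia (absoluteGaloisGroup (v.adicCompletion K)),
          Affine.Point.map ((absoluteGaloisGroup.toAlgEquiv _ σ :
              AlgebraicClosure (v.adicCompletion K) ≃ₐ[v.adicCompletion K]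
                AlgebraicClosure (v.adicCompletion K)) :
              AlgebraicClosure (v.adicCompletion K) →ₐ[v.adicCompletion K]
                AlgebraicClosure (v.adicCompletion K)) P = P) ∧
        ∃ k : ℕ, 2 ^ k • P = 0} := fun b ↦
    ⟨Φ ((b : Mi) : Pt), fun σ hσ ↦ by
        rw [← hΦ]
        exact congrArg Φ ((b : Mi).2 ⟨σ, hσ⟩), by
        obtain ⟨k, hk⟩ := (AddCommGroup.mem_primaryComponent).mp b.2
        refine ⟨k, ?_⟩
        rw [← map_nsmul, ← AddSubgroupClass.coe_nsmul, hk]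
        exact map_zero Φ⟩
  have hj : Function.Injective j := by
    intro a b hab
    have h := congrArg Subtype.val hab
    exact Subtype.ext (Subtype.ext (Φ.injective h))
  haveI : Finite B := Finite.of_injective j hj
  have hB3 : Nat.card B ≤ 3 := (Nat.card_le_card_of_injective j hj).trans hS
  -- a `2`-primary finite group of order `≤ 3` has order `≤ 2`
  have hB2 : Nat.card B ≤ 2 := by
    by_contra hne
    have h3 : Nat.card B = 3 := by omega
    haveI : Fintype B := Fintype.ofFinite _
    rw [Nat.card_eq_fintype_card] at h3
    have hdvd : 3 ∣ Fintype.card B := by rw [h3]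
    haveI : Fact (Nat.Prime 3) := ⟨Nat.prime_three⟩
    obtain ⟨x, hx⟩ := exists_prime_addOrderOf_dvd_card 3 hdvd
    obtain ⟨k, hk⟩ := (AddCommGroup.mem_primaryComponent).mp x.2
    have hxk : 2 ^ k • x = 0 := Subtype.ext (by rw [AddSubgroupClass.coe_nsmul, hk]; rfl)
    have hd : addOrderOf x ∣ 2 ^ k := addOrderOf_dvd_of_nsmul_eq_zero hxk
    rw [hx] at hd
    have : (3 : ℕ) = 2 := (Nat.prime_dvd_prime_iff_eq Nat.prime_three Nat.prime_two).mp (Nat.prime_three.dvd_of_dvd_pow hd)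
    omega
  exact finite_and_natCard_localTowerKerPrimary_le_of_inertiaPrimary W κ hpv n h𝔐 hgHn hgen (N := 2)
    inferInstance hB2

/-- **Corollary (counted currency): `#𝒦_{v,n}[2^∞][2] ≤ 2`** at an additive `v ∤ 2` of potentially good type.
[cite: GreenbergLNM1716, §3 Lemma 3.3 (proof, PDF p. 88)] -/
theorem pTorsion_le_two_of_additive_of_ne_Istar [W.IsElliptic]
    (hpv : ((2 : ℕ) : 𝓞 K) ∉ v.asIdeal) (hadd : W.HasAdditiveReductionAt v)
    (hpg : ∀ n, W.kodairaSymbolAt v ≠ .Istar n) (n : ℕ) :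
    Finite {x : W.localTowerKerPrimary κ (v.adicCompletion K) n // 2 • x = 0} ∧
      Nat.card {x : W.localTowerKerPrimary κ (v.adicCompletion K) n // 2 • x = 0} ≤ 2 := by
  obtain ⟨hfin, hle⟩ := finite_and_natCard_localTowerKerPrimary_le_two_of_additive_of_ne_Istar W κ hpv hadd hpg n
  haveI := hfin
  exact ⟨Finite.of_injective _ Subtype.val_injective,
    (Nat.card_le_card_of_injective _ Subtype.val_injective).trans hle⟩

end LocalPotGood

/-! ## §4 The certificate over `ℚ`: additive of potentially good type from `(ord_ℓ Δ_min, ord_ℓ c₄)` -/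

section PotGoodCert

variable (W : WeierstrassCurve ℚ) [W.IsElliptic] [W.IsGloballyMinimal]

/-- **Additive reduction of POTENTIALLY GOOD type (`≠ I_n*`) at an odd prime `ℓ`**, for a globally minimal `W/ℚ` at the place
`v ↔ ℓ`, from decidable data: `ℓ ∣ c₄`, `ℓ^k ∥ Δ_min`, `1 ≤ k`, `k ≠ 6`, `ℓ^k ∣ c₄³` (i.e. `ord_ℓ(j) ≥ 0`). Proof: additive by *AEC*
VII.5.1(c); type `I₀*` would give `ord_ℓ Δ_min = 5 + 1 = 6` (`ordMinimalDiscriminant_eq_numComponentsAt_add_one_of_kodairaSymbolAt`), type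
`I_n*` with `n ≥ 1` would give `ord_ℓ(j) < 0` (`one_lt_valuation_j_of_kodairaSymbolAt_eq_Istar_succ`).
[cite: SilvermanATAEC1994, IV.9.4 and Table 4.1 (PDF pp. 344–346, 365)] [cite: SilvermanAEC2009, VII.5 Prop. 5.1(c)] -/
theorem hasAdditiveReductionAt_and_ne_Istar_of_cert (v : HeightOneSpectrum (𝓞 ℚ)) {ℓ : ℕ}
    [Fact ℓ.Prime] (hv : (primesEquiv v : ℕ) = ℓ) (hℓ2 : ℓ ≠ 2)
    (hc₄ : (ℓ : ℤ) ∣ (integralModelInt W).c₄) {k : ℕ} (hk : (ℓ : ℤ) ^ k ∣ W.minimalDiscriminantInt)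
    (hk' : ¬ (ℓ : ℤ) ^ (k + 1) ∣ W.minimalDiscriminantInt) (hk1 : 1 ≤ k) (hk6 : k ≠ 6)
    (hj : (ℓ : ℤ) ^ k ∣ (integralModelInt W).c₄ ^ 3) :
    W.HasAdditiveReductionAt v ∧ ∀ n, W.kodairaSymbolAt v ≠ .Istar n := by
  haveI : PerfectField (IsLocalRing.ResidueField (v.adicCompletionIntegers ℚ)) := PerfectField.ofFinite
  have hℓΔ : (ℓ : ℤ) ∣ W.minimalDiscriminantInt := (dvd_pow_self (ℓ : ℤ) (by omega)).trans hk
  have hadd : W.HasAdditiveReductionAt v :=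
    W.hasAdditiveReductionAt_of_dvd_of_dvd v (by rw [hv]; exact hℓΔ) (by rw [hv]; exact hc₄)
  refine ⟨hadd, fun n h ↦ ?_⟩
  have h2v : ((2 : ℕ) : 𝓞 ℚ) ∉ v.asIdeal := by
    rw [KatoHalfPinch.natCast_prime_mem_asIdeal_iff v Nat.prime_two]
    change natGenerator v ≠ 2
    rw [show natGenerator v = ℓ from hv]; exact hℓ2
  have hchar : ringChar (𝓞 ℚ ⧸ v.asIdeal) ≠ 2 := ringChar_quot_ne_two v h2v
  have hordk : W.ordMinimalDiscriminant v = k := by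
    rw [LocalTorsionMult.ordMinimalDiscriminant_eq_padicValInt W v hv,
      KatoHalfPinch.padicValInt_eq_of_dvd_of_not_dvd hk hk']
  cases n with
  | zero =>
    have hord : W.ordMinimalDiscriminant v = W.numComponentsAt v + 1 :=
      W.ordMinimalDiscriminant_eq_numComponentsAt_add_one_of_kodairaSymbolAt v hchar (Or.inr (Or.inr ⟨0, h⟩))
    unfold numComponentsAt at hord
    rw [h, KodairaSymbol.numComponents_Istar] at hord
    omega
  | succ m =>
    have hlt := W.one_lt_valuation_j_of_kodairaSymbolAt_eq_Istar_succ v hchar h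
    exact absurd (valuation_j_le_one_of_dvd W v hv hk hk' hj) (not_le.mpr hlt)

end PotGoodCert

/-! ## §5 The per-place dispatcher with SIX disjuncts -/

section Dispatch6

variable (W : WeierstrassCurve ℚ) [W.IsElliptic]

/-- **The local constant at an odd place — six disjuncts.** `#𝒦_{v,n}[2] ≤ C` as soon as ONE of: `4 ≤ C`; `v` multiplicative and
`2 ≤ C`; `v` multiplicative with `2 ∤ ord_v(Δ_min)` and `1 ≤ C`; `v` good and `1 ≤ C`; `v` additive with `2 ∤ c̄_v` and `1 ≤ C` (ZERO bits);
**`v` additive of potentially good type (`≠ I_n*`) and `2 ≤ C` (ONE bit)**. [cite: GreenbergLNM1716, §3 Lemma 3.3 (PDF pp. 86–88)]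
[cite: SilvermanATAEC1994, Cor. IV.9.2(d) with Table 4.1] -/
theorem pTorsion_localTowerKer_le_of_numeric_addv2
    (h33g : lemma33_localTowerKerPrimary_eq_bot_of_good.{0})
    (hM : lemma33_localTowerKerPrimary_cyclic_of_multiplicative.{0})
    (hA : lemma33_natCard_localTowerKerPrimary_le_four_of_additive.{0})
    (κ : ZpExtension ℚ 2) (hκ : κ.IsCyclotomic) (v : HeightOneSpectrum (𝓞 ℚ))
    (h2v : ((2 : ℕ) : 𝓞 ℚ) ∉ v.asIdeal) (n C : ℕ)
    (hC : 4 ≤ C ∨ (W.HasMultiplicativeReductionAt v ∧ 2 ≤ C) ∨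
      (W.HasMultiplicativeReductionAt v ∧ ¬ 2 ∣ W.ordMinimalDiscriminant v ∧ 1 ≤ C) ∨
      (W.HasGoodReductionAt v ∧ 1 ≤ C) ∨
      (W.HasAdditiveReductionAt v ∧ ¬ 2 ∣ (W.kodairaSymbolAt v).componentGroupOrder ∧ 1 ≤ C) ∨
      (W.HasAdditiveReductionAt v ∧ (∀ m, W.kodairaSymbolAt v ≠ .Istar m) ∧ 2 ≤ C)) :
    Finite {x : W.localTowerKerPrimary κ (v.adicCompletion ℚ) n // 2 • x = 0} ∧
      Nat.card {x : W.localTowerKerPrimary κ (v.adicCompletion ℚ) n // 2 • x = 0} ≤ C := by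
  rcases hC with h | h | h | h | h | ⟨hadd, hpg, h2⟩
  · exact pTorsion_localTowerKer_le_of_numeric_addv W h33g hM hA κ hκ v h2v n C (Or.inl h)
  · exact pTorsion_localTowerKer_le_of_numeric_addv W h33g hM hA κ hκ v h2v n C (Or.inr (Or.inl h))
  · exact pTorsion_localTowerKer_le_of_numeric_addv W h33g hM hA κ hκ v h2v n C (Or.inr (Or.inr (Or.inl h)))
  · exact pTorsion_localTowerKer_le_of_numeric_addv W h33g hM hA κ hκ v h2v n C (Or.inr (Or.inr (Or.inr (Or.inl h))))
  · exact pTorsion_localTowerKer_le_of_numeric_addv W h33g hM hA κ hκ v h2v n C (Or.inr (Or.inr (Or.inr (Or.inr h))))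
  · obtain ⟨hf, hle⟩ := pTorsion_le_two_of_additive_of_ne_Istar W κ h2v hadd hpg n
    exact ⟨hf, hle.trans h2⟩

end Dispatch6

end Summit.BirchSwinnertonDyer.BirchSwinnertonDyer.Theorems.MultTowerAddv

end
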